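import Literature.Topology.FourManifolds.SphereTrisections
import Literature.Topology.FourManifolds.ClosedBallHandles
import HarnessLib

/-!
# The double intersections of Gay–Kirby's sectors of `S⁴` are `3`-balls: clause (iii) proved

Topic `Literature/Topology/FourManifolds`; sibling proof file of `SphereTrisections.lean` (fact item
`provefact-Literature.sphere_trisections`).  It DISCHARGES the named fact `Literature.Topology.FourManifolds.sphereSector_handlebodies`
(`SphereTrisections.lean`): clause (iii) of `Literature.Topology.FourManifolds.IsGKTrisection` for the explicit sectors
`X_j = {2πj/3 ≤ θ ≤ 2π(j+1)/3}` of the round `S⁴ ⊂ ℂ × ℝ³` (Gay–Kirby 2016, §2, first example) —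
every double intersection `X_i ∩ X_j`, `i ≠ j`, is the image of the closed unit `3`-ball `𝔻³`
(a compact connected smooth `3`-manifold with boundary carrying a handle decomposition with one
`0`-handle and no `1`-handle, `Literature.Topology.FourManifolds.hasHandleDecomposition_closedBall`, `ClosedBallHandles.lean`)
under a smooth embedding `𝔻³ → S⁴` sending `∂𝔻³ = S²` onto the central surface
`F = X₀ ∩ X₁ ∩ X₂ = {z = 0} ∩ S⁴` (Gay–Kirby, Def. 1, second bullet and the paragraph following it:
"consider the handlebodies `H_{ij} = X_i ∩ X_j` and the central genus `g` surface
`F_g = X_1 ∩ X_2 ∩ X_3 = ∂H_{ij}`", here with `g = 0`).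

## The embedding

For an angle `θ` let `u_θ = (cos θ, sin θ, 0, 0, 0)` (`sliceRay θ`) and `p_θ = -u_θ ∈ S⁴`
(`slicePole θ`).  The double intersection `X_i ∩ X_{i+1}` is the closed half great `3`-sphere
`R_θ = {x ∈ S⁴ | (x₀, x₁) = s u_θ, s ≥ 0}` (`halfGreatSphere θ`) with `θ = 2π/3, 4π/3, 0`
(`SphereTrisections.lean`: `GayKirby.sphereSector_zero_inter_one`, `…_one_inter_two`,
`…_two_inter_zero`).  Following the docstring of `Literature.Topology.FourManifolds.IsGKTrisection` ("`H_{j,j+1}` is the image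
of the closed unit `3`-ball under the inverse stereographic projection (from the antipode
`(-e^{iθ}, 0)`) of the great `3`-sphere `S⁴ ∩ (ℝe^{iθ} × ℝ³)`") we define the **slice map**
`sliceMap θ : 𝔻³ → S⁴`, `x ↦ σ_{p_θ}⁻¹ (2 · sliceEmb θ x)`, where `σ_{p_θ} = stereographic' 4 p_θ`
is Mathlib's stereographic chart of `S⁴` from `p_θ` and `sliceEmb θ : ℝ³ → ℝ⁴` is the isometric
embedding `y ↦ U (0, 0, y)` (`U` Mathlib's identification `(ℝ p_θ)ᗮ ≃ₗᵢ ℝ⁴`); explicitly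
(`coe_sliceMap`) `sliceMap θ x = ((1 - ‖x‖²) u_θ + 2 (0, 0, x)) / (1 + ‖x‖²)`, the classical
parametrisation of the hemisphere `{⟨·, u_θ⟫ ≥ 0}` of the great `3`-sphere through `±u_θ` and `ℝ³`
(Hirsch, *Differential Topology*, §1.1).  We prove: `range (sliceMap θ) = R_θ` (`range_sliceMap`),
`sliceMap θ (∂𝔻³) = {z = 0} ∩ S⁴` (`image_sliceMap_boundary`, with `Literature.Topology.FourManifolds.boundary_closedBall`), and
that `sliceMap θ` is a smooth embedding for the manifold-with-boundary structure
`Literature.Topology.FourManifolds.instChartedSpaceClosedBall` on `𝔻³` (`isSmoothEmbedding_sliceMap`): a topological embedding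
(injective and continuous on a compact space) and an immersion in Mathlib's chart sense
(`Manifold.IsImmersion`), by the argument of `Literature.Topology.FourManifolds.isSmoothEmbedding_hemisphereMap`
(`ClosedBallProofs.lean`) with the positive-codimension complement `ℝ`: in the chart `e` of `𝔻³` at
`x` (the translated interior chart, or the polar boundary chart of `ClosedBall.lean`, both of which
extend to partial diffeomorphisms `D` of `ℝ³`) and the chart `σ_{p_θ}/2` of `S⁴` modified by the
partial diffeomorphism `sliceEquiv ∘ (D × id_ℝ) ∘ sliceEquiv⁻¹` of `ℝ⁴`, where
`sliceEquiv θ : ℝ³ × ℝ ≃L ℝ⁴`, `(y, t) ↦ U ((0, 0, y) + t w_θ)`, `w_θ = (-sin θ, cos θ, 0, 0, 0)`,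
the slice map reads `y ↦ sliceEquiv (y, 0)` (`isImmersionAtOfComplement_sliceMap_of_charts`).

## Main results

* `Literature.Topology.FourManifolds.GayKirby.isSmoothEmbedding_sliceMap`, `Literature.Topology.FourManifolds.GayKirby.range_sliceMap`,
  `Literature.Topology.FourManifolds.GayKirby.image_sliceMap_boundary`;
* `Literature.sphereSector_handlebodies_holds : sphereSector_handlebodies` — clause (iii) discharged;
* `Literature.Topology.FourManifolds.sphereSector_isBalancedGKTrisection_of_sectors`, `Literature.Topology.FourManifolds.sphere_gkTrisections_of_sectors`:
  the genus-`0` fact, resp. (d′) `sphere_gkTrisections`, now follow from clause (ii)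
  `sphereSector_sectors` (resp. and the stabilisation fact (c′) `exists_stabilized_gkTrisection`)
  alone.  (Clause (ii) is discharged in turn in the later sibling `SphereTrisectionsSectors.lean`,
  `Literature.Topology.FourManifolds.sphereSector_sectors_holds`, leaving (d′) ⇐ (c′): `Literature.Topology.FourManifolds.sphere_gkTrisections_of_stabilization`.)
  Clause labels (i)–(iii) are those of `Literature.Topology.FourManifolds.IsGKTrisection` (union; sectors; double intersections).

## References

* D. Gay, R. Kirby, *Trisecting 4-manifolds*, Geom. Topol. 20 (2016) 3097–3132 (arXiv:1205.1565):
  Def. 1 (arXiv p. 3: two bullets, and the paragraph following it), §2, first example (arXiv p. 5).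
* M. W. Hirsch, *Differential Topology*, Springer GTM 33 (1976), §1.1 (stereographic atlas of `Sⁿ`),
  §1.4 (manifolds with boundary).
-/

noncomputable section

open scoped Manifold ContDiff Topology InnerProductSpace Real
open Set Function Metric WithLp

namespace Literature.Topology.FourManifolds

local notation "𝔼 " n:arg => EuclideanSpace ℝ (Fin n)
local notation "𝕊 " n:arg => (Metric.sphere (0 : EuclideanSpace ℝ (Fin (n + 1))) 1)
local notation "𝔻 " n:arg => (Metric.closedBall (0 : EuclideanSpace ℝ (Fin n)) 1)

attribute [local instance] fact_finrank_euclideanSpace_succ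


namespace GayKirby

/-- The unit vector `u_θ = (cos θ, sin θ, 0, 0, 0)` of `ℝ⁵ = ℂ × ℝ³`. [folklore] -/
def sliceRay (θ : ℝ) : 𝔼 5 := !₂[Real.cos θ, Real.sin θ, 0, 0, 0]

/-- `(u_θ)₀ = cos θ`. [folklore] -/
@[simp] theorem sliceRay_apply_zero (θ : ℝ) : sliceRay θ 0 = Real.cos θ := rfl
/-- `(u_θ)₁ = sin θ`. [folklore] -/
@[simp] theorem sliceRay_apply_one (θ : ℝ) : sliceRay θ 1 = Real.sin θ := rfl
/-- `(u_θ)₂ = 0`. [folklore] -/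
@[simp] theorem sliceRay_apply_two (θ : ℝ) : sliceRay θ 2 = 0 := rfl
/-- `(u_θ)₃ = 0`. [folklore] -/
@[simp] theorem sliceRay_apply_three (θ : ℝ) : sliceRay θ 3 = 0 := rfl
/-- `(u_θ)₄ = 0`. [folklore] -/
@[simp] theorem sliceRay_apply_four (θ : ℝ) : sliceRay θ 4 = 0 := rfl

/-- `u_θ` is a unit vector. [folklore] -/
theorem norm_sliceRay (θ : ℝ) : ‖sliceRay θ‖ = 1 := by
  rw [EuclideanSpace.norm_eq]
  simp [Fin.sum_univ_five, Real.cos_sq_add_sin_sq]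

/-- The tail embedding `ℝ³ → ℝ⁵ = ℂ × ℝ³`, `y ↦ (0, y) = (0, 0, y₀, y₁, y₂)`. [folklore] -/
def sliceTail (y : 𝔼 3) : 𝔼 5 := !₂[0, 0, y 0, y 1, y 2]

/-- `(0, 0, y)₀ = 0`. [folklore] -/
@[simp] theorem sliceTail_apply_zero (y : 𝔼 3) : sliceTail y 0 = 0 := rfl
/-- `(0, 0, y)₁ = 0`. [folklore] -/
@[simp] theorem sliceTail_apply_one (y : 𝔼 3) : sliceTail y 1 = 0 := rfl
/-- `(0, 0, y)₂ = y₀`. [folklore] -/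
@[simp] theorem sliceTail_apply_two (y : 𝔼 3) : sliceTail y 2 = y 0 := rfl
/-- `(0, 0, y)₃ = y₁`. [folklore] -/
@[simp] theorem sliceTail_apply_three (y : 𝔼 3) : sliceTail y 3 = y 1 := rfl
/-- `(0, 0, y)₄ = y₂`. [folklore] -/
@[simp] theorem sliceTail_apply_four (y : 𝔼 3) : sliceTail y 4 = y 2 := rfl

/-- `y ↦ (0, 0, y)` is additive. [folklore] -/
theorem sliceTail_add (y y' : 𝔼 3) : sliceTail (y + y') = sliceTail y + sliceTail y' := by
  ext i; fin_cases i <;> simp [sliceTail]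

/-- `y ↦ (0, 0, y)` is homogeneous. [folklore] -/
theorem sliceTail_smul (c : ℝ) (y : 𝔼 3) : sliceTail (c • y) = c • sliceTail y := by
  ext i; fin_cases i <;> simp [sliceTail]

/-- `‖(0, 0, y)‖ = ‖y‖`. [folklore] -/
theorem norm_sliceTail (y : 𝔼 3) : ‖sliceTail y‖ = ‖y‖ := by
  simp [EuclideanSpace.norm_eq, Fin.sum_univ_five, Fin.sum_univ_three]

/-- `(0, 0, y) ⊥ u_θ`. [folklore] -/
theorem inner_sliceTail_sliceRay (y : 𝔼 3) (θ : ℝ) : ⟪sliceTail y, sliceRay θ⟫_ℝ = 0 := by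
  simp [EuclideanSpace.inner_eq_star_dotProduct, Fin.sum_univ_five, dotProduct, sliceTail, sliceRay]

/-- `sliceTail` as a linear map. [folklore] -/
def sliceTailₗ : (𝔼 3) →ₗ[ℝ] 𝔼 5 where
  toFun := sliceTail
  map_add' := sliceTail_add
  map_smul' := sliceTail_smul

/-- The pole `p_θ = -u_θ ∈ S⁴` of the slice chart. [folklore] -/
def slicePole (θ : ℝ) : 𝕊 4 := ⟨-sliceRay θ, by simp [norm_sliceRay]⟩

/-- The slicePole as a vector: `p_θ = -u_θ`. [folklore] -/
@[simp] theorem coe_slicePole (θ : ℝ) : ((slicePole θ : 𝕊 4) : 𝔼 5) = -sliceRay θ := rfl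

/-- `sliceTail y` is orthogonal to the pole. [folklore] -/
theorem sliceTail_mem_orthogonal (θ : ℝ) (y : 𝔼 3) : sliceTail y ∈ (ℝ ∙ ((slicePole θ : 𝕊 4) : 𝔼 5))ᗮ := by
  rw [Submodule.mem_orthogonal_singleton_iff_inner_right, coe_slicePole, inner_neg_left,
    real_inner_comm, inner_sliceTail_sliceRay, neg_zero]

/-- The slice embedding of the model `ℝ³` into the stereographic chart of `S⁴` at the pole `p_θ`:
`y ↦ U (0, 0, y)` with `U` Mathlib's identification `(ℝ p_θ)ᗮ ≃ₗᵢ ℝ⁴`. [folklore] -/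
def sliceEmb (θ : ℝ) (y : 𝔼 3) : 𝔼 4 :=
  (OrthonormalBasis.fromOrthogonalSpanSingleton (𝕜 := ℝ) 4
    (ne_zero_of_mem_unit_sphere (slicePole θ))).repr ⟨sliceTail y, sliceTail_mem_orthogonal θ y⟩

/-- The slice embedding preserves norms. [folklore] -/
theorem norm_sliceEmb (θ : ℝ) (y : 𝔼 3) : ‖sliceEmb θ y‖ = ‖y‖ := by
  rw [sliceEmb, LinearIsometryEquiv.norm_map, ← norm_sliceTail y]
  exact (Submodule.coe_norm (⟨sliceTail y, sliceTail_mem_orthogonal θ y⟩ : (ℝ ∙ ((slicePole θ : 𝕊 4) : 𝔼 5))ᗮ)).symm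

/-- The slice embedding is additive. [folklore] -/
theorem sliceEmb_add (θ : ℝ) (y y' : 𝔼 3) : sliceEmb θ (y + y') = sliceEmb θ y + sliceEmb θ y' := by
  rw [sliceEmb, sliceEmb, sliceEmb, ← map_add]
  congr 1
  exact Subtype.ext (sliceTail_add y y')

/-- The slice embedding is homogeneous. [folklore] -/
theorem sliceEmb_smul (θ : ℝ) (c : ℝ) (y : 𝔼 3) : sliceEmb θ (c • y) = c • sliceEmb θ y := by
  rw [sliceEmb, sliceEmb, ← map_smul]
  congr 1
  exact Subtype.ext (sliceTail_smul c y)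

/-- Undoing Mathlib's identification `U`: the slice embedding is `sliceTail` inside `(ℝ p_θ)ᗮ`. [folklore] -/
theorem repr_symm_sliceEmb (θ : ℝ) (y : 𝔼 3) :
    (((OrthonormalBasis.fromOrthogonalSpanSingleton (𝕜 := ℝ) 4
      (ne_zero_of_mem_unit_sphere (slicePole θ))).repr.symm (sliceEmb θ y) : (ℝ ∙ ((slicePole θ : 𝕊 4) : 𝔼 5))ᗮ) : 𝔼 5)
      = sliceTail y := by
  rw [sliceEmb, LinearIsometryEquiv.symm_apply_apply]

/-- **The slice map** `𝔻³ → S⁴`, `x ↦ σ_{p_θ}⁻¹ (2 · sliceEmb θ x)`: the closed half of the great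
`3`-sphere `S⁴ ∩ (ℝ u_θ ⊕ ℝ³)` on the side of `u_θ`, parametrised by the closed `3`-ball through
the stereographic projection from the antipode `p_θ = -u_θ`. [folklore] -/
def sliceMap (θ : ℝ) (x : 𝔻 3) : 𝕊 4 :=
  (stereographic' 4 (slicePole θ)).symm ((2 : ℝ) • sliceEmb θ (x : 𝔼 3))

/-- Explicit formula. [folklore] -/
theorem coe_sliceMap (θ : ℝ) (x : 𝔻 3) :
    ((sliceMap θ x : 𝕊 4) : 𝔼 5) =
      (‖(x : 𝔼 3)‖ ^ 2 + 1)⁻¹ • ((2 : ℝ) • sliceTail (x : 𝔼 3) + (1 - ‖(x : 𝔼 3)‖ ^ 2) • sliceRay θ) := by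
  rw [sliceMap, ← sliceEmb_smul, stereographic'_symm_apply]
  dsimp only
  rw [repr_symm_sliceEmb, coe_slicePole, sliceTail_smul, norm_smul, norm_sliceTail, Real.norm_two, mul_pow]
  have h : (‖(x : 𝔼 3)‖ ^ 2 + 1) ≠ 0 := by positivity
  have h4 : ((2:ℝ) ^ 2 * ‖(x : 𝔼 3)‖ ^ 2 + 4) ≠ 0 := by positivity
  rw [smul_add, smul_neg, ← neg_smul]
  match_scalars
  · field_simp
    ring
  · field_simp
    ring



/-- The closed ray set `R_θ = {x ∈ S⁴ | (x₀, x₁) = s (cos θ, sin θ), s ≥ 0}` (a closed half great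
`3`-sphere). [folklore] -/
def halfGreatSphere (θ : ℝ) : Set (𝕊 4) :=
  {x | ∃ s : ℝ, 0 ≤ s ∧ (x : 𝔼 5) 0 = s * Real.cos θ ∧ (x : 𝔼 5) 1 = s * Real.sin θ}

/-- Coordinates of the slice map. [folklore] -/
theorem sliceMap_apply (θ : ℝ) (x : 𝔻 3) (i : Fin 5) :
    ((sliceMap θ x : 𝕊 4) : 𝔼 5) i =
      (‖(x : 𝔼 3)‖ ^ 2 + 1)⁻¹ * (2 * sliceTail (x : 𝔼 3) i + (1 - ‖(x : 𝔼 3)‖ ^ 2) * sliceRay θ i) := by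
  rw [coe_sliceMap]
  simp [mul_add]

/-- The slice map takes values in the ray set, with parameter `s = (1 - ‖x‖²)/(1 + ‖x‖²)`. [folklore] -/
theorem sliceMap_mem_halfGreatSphere (θ : ℝ) (x : 𝔻 3) : sliceMap θ x ∈ halfGreatSphere θ := by
  have h1 : ‖(x : 𝔼 3)‖ ≤ 1 := mem_closedBall_zero_iff.1 x.2
  have h0 : 0 ≤ ‖(x : 𝔼 3)‖ := norm_nonneg _
  refine ⟨(‖(x : 𝔼 3)‖ ^ 2 + 1)⁻¹ * (1 - ‖(x : 𝔼 3)‖ ^ 2), ?_, ?_, ?_⟩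
  · exact mul_nonneg (by positivity) (by nlinarith)
  · rw [sliceMap_apply]; simp; ring
  · rw [sliceMap_apply]; simp; ring

/-- The sliceTail projection `ℝ⁵ → ℝ³`, `v ↦ (v₂, v₃, v₄)`. [folklore] -/
def sliceTailProj (v : 𝔼 5) : 𝔼 3 := !₂[v 2, v 3, v 4]

/-- `sliceTailProj v` has coordinates `(v₂, v₃, v₄)`. [folklore] -/
@[simp] theorem sliceTailProj_apply_zero (v : 𝔼 5) : sliceTailProj v 0 = v 2 := rfl
/-- `sliceTailProj v` has coordinates `(v₂, v₃, v₄)`. [folklore] -/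
@[simp] theorem sliceTailProj_apply_one (v : 𝔼 5) : sliceTailProj v 1 = v 3 := rfl
/-- `sliceTailProj v` has coordinates `(v₂, v₃, v₄)`. [folklore] -/
@[simp] theorem sliceTailProj_apply_two (v : 𝔼 5) : sliceTailProj v 2 = v 4 := rfl

/-- `‖v‖² = v₀² + v₁² + ‖(v₂, v₃, v₄)‖²` in `ℝ⁵`. [folklore] -/
theorem norm_sq_eq_of_fin_five (v : 𝔼 5) :
    ‖v‖ ^ 2 = v 0 ^ 2 + v 1 ^ 2 + ‖sliceTailProj v‖ ^ 2 := by
  rw [EuclideanSpace.norm_sq_eq, EuclideanSpace.norm_sq_eq]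
  simp [Fin.sum_univ_five, Fin.sum_univ_three, sliceTailProj]
  ring

/-- On the ray set, `‖sliceTailProj x‖² = 1 - s²`. [folklore] -/
theorem norm_sliceTailProj_sq_of_mem {θ s : ℝ} {x : 𝕊 4} (hx0 : (x : 𝔼 5) 0 = s * Real.cos θ)
    (hx1 : (x : 𝔼 5) 1 = s * Real.sin θ) : ‖sliceTailProj (x : 𝔼 5)‖ ^ 2 = 1 - s ^ 2 := by
  have h := norm_sq_eq_of_fin_five (x : 𝔼 5)
  rw [norm_eq_of_mem_sphere x, hx0, hx1] at h
  nlinarith [Real.cos_sq_add_sin_sq θ]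

/-- **The image of the slice map is the closed half great `3`-sphere `R_θ`** (the hemisphere
`{⟪·, u_θ⟫ ≥ 0}` of the great `3`-sphere `S⁴ ∩ (ℝ u_θ ⊕ ℝ³)`; preimage of `x` is
`(x₂, x₃, x₄)/(1 + s)`). [cite: GayKirby2016, §2 (arXiv p. 5), first example] -/
theorem range_sliceMap (θ : ℝ) : range (sliceMap θ) = halfGreatSphere θ := by
  refine Subset.antisymm (by rintro _ ⟨x, rfl⟩; exact sliceMap_mem_halfGreatSphere θ x) fun x ⟨s, hs, hx0, hx1⟩ => ?_
  have htail := norm_sliceTailProj_sq_of_mem hx0 hx1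
  have hs1 : s ≤ 1 := by nlinarith [norm_nonneg (sliceTailProj (x : 𝔼 5))]
  have hpos : 0 < 1 + s := by linarith
  set y : 𝔼 3 := (1 + s)⁻¹ • sliceTailProj (x : 𝔼 5) with hy
  have hny : ‖y‖ ^ 2 = (1 - s) / (1 + s) := by
    rw [hy, norm_smul, mul_pow, htail, norm_inv, Real.norm_eq_abs, abs_of_pos hpos]
    field_simp
    ring
  have hy1 : ‖y‖ ≤ 1 := by
    have : ‖y‖ ^ 2 ≤ 1 := by
      rw [hny, div_le_one hpos]; linarith
    nlinarith [norm_nonneg y]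
  refine ⟨⟨y, mem_closedBall_zero_iff.2 hy1⟩, ?_⟩
  ext i
  simp only [sliceMap_apply, hny]
  have hc : ((1 - s) / (1 + s) + 1)⁻¹ = (1 + s) / 2 := by
    field_simp; ring
  rw [hc]
  fin_cases i
  · simp [hx0]; field_simp; ring
  · simp [hx1]; field_simp; ring
  · simp [hy, sliceTail]; field_simp
  · simp [hy, sliceTail]; field_simp
  · simp [hy, sliceTail]; field_simp

/-- **The slice map sends the boundary `2`-sphere `∂𝔻³ = {‖x‖ = 1}` (`Literature.Topology.FourManifolds.boundary_closedBall`)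
exactly onto the central surface `{z = 0} ∩ S⁴`** (`∂H_{ij} = F`). [cite: GayKirby2016, Def. 1, paragraph following it (arXiv p. 3); §2 (arXiv p. 5), first example] -/
theorem image_sliceMap_boundary (θ : ℝ) :
    sliceMap θ '' (𝓡∂ 3).boundary (𝔻 3) = {x : 𝕊 4 | (x : 𝔼 5) 0 = 0 ∧ (x : 𝔼 5) 1 = 0} := by
  rw [boundary_closedBall]
  ext x
  constructor
  · rintro ⟨y, hy, rfl⟩
    rw [mem_setOf_eq] at hy
    simp [sliceMap_apply, hy]
  · rintro ⟨hx0, hx1⟩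
    -- `x` is on the ray set with `s = 0`, the preimage found in `range_sliceMap` has norm `1`
    have hx : x ∈ halfGreatSphere θ := ⟨0, le_rfl, by simp [hx0], by simp [hx1]⟩
    rw [← range_sliceMap] at hx
    obtain ⟨y, rfl⟩ := hx
    refine ⟨y, ?_, rfl⟩
    rw [mem_setOf_eq]
    -- from `x₀ = 0`: `(1 - ‖y‖²) cos θ = 0` and `(1 - ‖y‖²) sin θ = 0`
    have h0 := hx0
    have h1 := hx1
    rw [sliceMap_apply] at h0 h1
    simp only [sliceTail_apply_zero, sliceRay_apply_zero, mul_zero, zero_add, sliceTail_apply_one,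
      sliceRay_apply_one, mul_eq_zero, inv_eq_zero] at h0 h1
    have hne : ‖(y : 𝔼 3)‖ ^ 2 + 1 ≠ 0 := by positivity
    have h : 1 - ‖(y : 𝔼 3)‖ ^ 2 = 0 := by
      rcases h0 with h0 | h0 | h0
      · exact absurd h0 hne
      · exact h0
      · rcases h1 with h1 | h1 | h1
        · exact absurd h1 hne
        · exact h1
        · exfalso
          have := Real.cos_sq_add_sin_sq θ
          rw [h0, h1] at this
          norm_num at this
    nlinarith [norm_nonneg (y : 𝔼 3)]


/-! ### The slice map is a smooth embedding -/

/-- The slice embedding is injective (it is norm preserving and linear). [folklore] -/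
theorem sliceEmb_injective (θ : ℝ) : Injective (sliceEmb θ) := by
  intro y y' h
  have h0 : sliceEmb θ (y - y') = 0 := by
    rw [sub_eq_add_neg, sliceEmb_add, ← neg_one_smul ℝ y', sliceEmb_smul, h, neg_one_smul,
      add_neg_cancel]
  have := norm_sliceEmb θ (y - y')
  rw [h0, norm_zero] at this
  exact sub_eq_zero.1 (norm_eq_zero.1 this.symm)

/-- Continuity of the slice embedding (a linear map of finite-dimensional spaces). [folklore] -/
theorem continuous_sliceEmb (θ : ℝ) : Continuous (sliceEmb θ) := by
  have htail : Continuous sliceTail := LinearMap.continuous_of_finiteDimensional sliceTailₗ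
  unfold sliceEmb
  exact (LinearIsometryEquiv.continuous _).comp (htail.subtype_mk _)

/-- The slice map is continuous. [folklore] -/
theorem continuous_sliceMap (θ : ℝ) : Continuous (sliceMap θ) := by
  have h2 : Continuous (stereographic' 4 (slicePole θ)).symm := by
    rw [← continuousOn_univ, ← stereographic'_target (slicePole θ)]
    exact (stereographic' 4 (slicePole θ)).continuousOn_symm
  exact h2.comp (((continuous_sliceEmb θ).comp continuous_subtype_val).const_smul (2 : ℝ))

/-- The slice map avoids the pole. [folklore] -/
theorem sliceMap_mem_source (θ : ℝ) (x : 𝔻 3) :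
    sliceMap θ x ∈ (stereographic' 4 (slicePole θ)).source :=
  (stereographic' 4 (slicePole θ)).map_target (by simp)

/-- The stereographic chart from the pole inverts the slice map: `σ (h x) = 2 · sliceEmb θ x`. [folklore] -/
@[simp]
theorem stereographic'_sliceMap (θ : ℝ) (x : 𝔻 3) :
    stereographic' 4 (slicePole θ) (sliceMap θ x) = (2 : ℝ) • sliceEmb θ (x : 𝔼 3) :=
  (stereographic' 4 (slicePole θ)).right_inv (by simp)

/-- The slice map is injective. [folklore] -/
theorem injective_sliceMap (θ : ℝ) : Injective (sliceMap θ) := by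
  intro x y hxy
  have h := congr_arg (stereographic' 4 (slicePole θ)) hxy
  rw [stereographic'_sliceMap, stereographic'_sliceMap] at h
  exact Subtype.ext (sliceEmb_injective θ (smul_right_injective (𝔼 4) (two_ne_zero (α := ℝ)) h))

/-- The slice map is a closed topological embedding (injective, continuous, compact domain). [folklore] -/
theorem isEmbedding_sliceMap (θ : ℝ) : Topology.IsEmbedding (sliceMap θ) :=
  ((continuous_sliceMap θ).isClosedEmbedding (injective_sliceMap θ)).isEmbedding

/-! #### The linear model: `ℝ³ × ℝ ≃ (ℝ p_θ)ᗮ ≃ ℝ⁴` -/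

/-- The unit vector `w_θ = (-sin θ, cos θ, 0, 0, 0)` completing `sliceTail(ℝ³)` to `(ℝ p_θ)ᗮ`. [folklore] -/
def slicePerp (θ : ℝ) : 𝔼 5 := !₂[-Real.sin θ, Real.cos θ, 0, 0, 0]

/-- `(w_θ)₀ = -sin θ`. [folklore] -/
@[simp] theorem slicePerp_apply_zero (θ : ℝ) : slicePerp θ 0 = -Real.sin θ := rfl
/-- `(w_θ)₁ = cos θ`. [folklore] -/
@[simp] theorem slicePerp_apply_one (θ : ℝ) : slicePerp θ 1 = Real.cos θ := rfl
/-- `(w_θ)₂ = 0`. [folklore] -/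
@[simp] theorem slicePerp_apply_two (θ : ℝ) : slicePerp θ 2 = 0 := rfl
/-- `(w_θ)₃ = 0`. [folklore] -/
@[simp] theorem slicePerp_apply_three (θ : ℝ) : slicePerp θ 3 = 0 := rfl
/-- `(w_θ)₄ = 0`. [folklore] -/
@[simp] theorem slicePerp_apply_four (θ : ℝ) : slicePerp θ 4 = 0 := rfl

/-- `w_θ ⊥ u_θ`. [folklore] -/
theorem inner_slicePerp_sliceRay (θ : ℝ) : ⟪slicePerp θ, sliceRay θ⟫_ℝ = 0 := by
  simp [EuclideanSpace.inner_eq_star_dotProduct, Fin.sum_univ_five, dotProduct, slicePerp, sliceRay]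
  ring

/-- The linear parametrisation `(y, t) ↦ (0, 0, y) + t w_θ` of `ℝ⁵`. [folklore] -/
def sliceLin (θ : ℝ) : (𝔼 3) × ℝ →ₗ[ℝ] 𝔼 5 :=
  sliceTailₗ.comp (LinearMap.fst ℝ (𝔼 3) ℝ) + (LinearMap.snd ℝ (𝔼 3) ℝ).smulRight (slicePerp θ)

/-- Unfolding of `sliceLin`. [folklore] -/
theorem sliceLin_apply (θ : ℝ) (q : (𝔼 3) × ℝ) : sliceLin θ q = sliceTail q.1 + q.2 • slicePerp θ := rfl

/-- `sliceLin` takes values in `(ℝ p_θ)ᗮ` (`(0,0,y)` and `w_θ` are orthogonal to `u_θ`). [folklore] -/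
theorem sliceLin_mem_orthogonal (θ : ℝ) (q : (𝔼 3) × ℝ) :
    sliceLin θ q ∈ (ℝ ∙ ((slicePole θ : 𝕊 4) : 𝔼 5))ᗮ := by
  rw [Submodule.mem_orthogonal_singleton_iff_inner_right, coe_slicePole, inner_neg_left,
    sliceLin_apply, inner_add_right, real_inner_smul_right, real_inner_comm (sliceTail q.1) (sliceRay θ),
    real_inner_comm (slicePerp θ) (sliceRay θ), inner_sliceTail_sliceRay, inner_slicePerp_sliceRay]
  simp

/-- The inverse linear map `v ↦ ((v₂, v₃, v₄), -sin θ v₀ + cos θ v₁)` on `ℝ⁵`. [folklore] -/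
def sliceLinInv (θ : ℝ) : (𝔼 5) →ₗ[ℝ] (𝔼 3) × ℝ where
  toFun v := (sliceTailProj v, -Real.sin θ * v 0 + Real.cos θ * v 1)
  map_add' v w := by
    ext i
    · fin_cases i <;> simp [sliceTailProj]
    · simp; ring
  map_smul' c v := by
    ext i
    · fin_cases i <;> simp [sliceTailProj]
    · simp; ring

/-- `sliceLinInv ∘ sliceLin = id`. [folklore] -/
theorem sliceLinInv_sliceLin (θ : ℝ) (q : (𝔼 3) × ℝ) : sliceLinInv θ (sliceLin θ q) = q := by
  obtain ⟨y, t⟩ := q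
  ext i
  · fin_cases i <;> simp [sliceLinInv, sliceLin_apply, sliceTailProj, sliceTail]
  · simp [sliceLinInv, sliceLin_apply]
    linear_combination t * Real.sin_sq_add_cos_sq θ

/-- On vectors orthogonal to the pole, `sliceLin ∘ sliceLinInv = id` (`(v₀, v₁) ⊥ (cos θ, sin θ)`
forces `(v₀, v₁) = λ (-sin θ, cos θ)`). [folklore] -/
theorem sliceLin_sliceLinInv {θ : ℝ} {v : 𝔼 5} (hv : v ∈ (ℝ ∙ ((slicePole θ : 𝕊 4) : 𝔼 5))ᗮ) :
    sliceLin θ (sliceLinInv θ v) = v := by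
  rw [Submodule.mem_orthogonal_singleton_iff_inner_right, coe_slicePole, inner_neg_left, neg_eq_zero] at hv
  have h : Real.cos θ * v 0 + Real.sin θ * v 1 = 0 := by
    simpa [EuclideanSpace.inner_eq_star_dotProduct, Fin.sum_univ_five, dotProduct, sliceRay,
      mul_comm] using hv
  have hcs := Real.sin_sq_add_cos_sq θ
  ext i
  fin_cases i
  · simp [sliceLin_apply, sliceLinInv, sliceTail]
    linear_combination (-Real.cos θ) * h + v 0 * hcs
  · simp [sliceLin_apply, sliceLinInv, sliceTail]
    linear_combination (-Real.sin θ) * h + v 1 * hcs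
  · simp [sliceLin_apply, sliceLinInv, sliceTail]
  · simp [sliceLin_apply, sliceLinInv, sliceTail]
  · simp [sliceLin_apply, sliceLinInv, sliceTail]

/-- `ℝ³ × ℝ ≃ₗ (ℝ p_θ)ᗮ`. [folklore] -/
def sliceLinEquiv (θ : ℝ) : ((𝔼 3) × ℝ) ≃ₗ[ℝ] (ℝ ∙ ((slicePole θ : 𝕊 4) : 𝔼 5))ᗮ :=
  LinearEquiv.ofLinear ((sliceLin θ).codRestrict _ (sliceLin_mem_orthogonal θ))
    ((sliceLinInv θ).comp (Submodule.subtype _))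
    (LinearMap.ext fun v => Subtype.ext (sliceLin_sliceLinInv v.2))
    (LinearMap.ext fun q => sliceLinInv_sliceLin θ q)

/-- **The immersion complement datum**: `ℝ³ × ℝ ≃L ℝ⁴`, `(y, t) ↦ U ((0, 0, y) + t w_θ)`, extending
the slice embedding: `sliceEquiv θ (y, 0) = sliceEmb θ y`. [folklore] -/
def sliceEquiv (θ : ℝ) : ((𝔼 3) × ℝ) ≃L[ℝ] 𝔼 4 :=
  ((sliceLinEquiv θ).trans (OrthonormalBasis.fromOrthogonalSpanSingleton (𝕜 := ℝ) 4
    (ne_zero_of_mem_unit_sphere (slicePole θ))).repr.toLinearEquiv).toContinuousLinearEquiv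

/-- `sliceEquiv` extends the slice embedding: `sliceEquiv θ (y, 0) = sliceEmb θ y`. [folklore] -/
theorem sliceEquiv_apply_zero (θ : ℝ) (y : 𝔼 3) : sliceEquiv θ (y, 0) = sliceEmb θ y := by
  simp only [sliceEquiv, LinearEquiv.coe_toContinuousLinearEquiv', LinearEquiv.trans_apply,
    LinearIsometryEquiv.coe_toLinearEquiv, sliceEmb]
  congr 1
  refine Subtype.ext ?_
  show sliceLin θ (y, 0) = sliceTail y
  simp [sliceLin_apply]

/-- Inverse form: `sliceEquiv⁻¹ (sliceEmb θ y) = (y, 0)`. [folklore] -/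
theorem sliceEquiv_symm_sliceEmb (θ : ℝ) (y : 𝔼 3) : (sliceEquiv θ).symm (sliceEmb θ y) = (y, 0) := by
  rw [ContinuousLinearEquiv.symm_apply_eq, sliceEquiv_apply_zero]

/-! #### The codomain charts -/

/-- The modification `equiv ∘ (D × id) ∘ equiv⁻¹` of the model `ℝ⁴` by a partial homeomorphism
`D` of `ℝ³`. [folklore] -/
def sliceCodMod (θ : ℝ) (D : OpenPartialHomeomorph (𝔼 3) (𝔼 3)) :
    OpenPartialHomeomorph (𝔼 4) (𝔼 4) :=
  ((sliceEquiv θ).symm.toHomeomorph.toOpenPartialHomeomorph ≫ₕ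
    D.prod (OpenPartialHomeomorph.refl ℝ)) ≫ₕ (sliceEquiv θ).toHomeomorph.toOpenPartialHomeomorph

/-- Unfolding of `sliceCodMod`. [folklore] -/
theorem sliceCodMod_apply (θ : ℝ) (D : OpenPartialHomeomorph (𝔼 3) (𝔼 3)) (w : 𝔼 4) :
    sliceCodMod θ D w = sliceEquiv θ (D ((sliceEquiv θ).symm w).1, ((sliceEquiv θ).symm w).2) := rfl

/-- Unfolding of the inverse of `sliceCodMod`. [folklore] -/
theorem sliceCodMod_symm_apply (θ : ℝ) (D : OpenPartialHomeomorph (𝔼 3) (𝔼 3)) (w : 𝔼 4) :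
    (sliceCodMod θ D).symm w =
      sliceEquiv θ (D.symm ((sliceEquiv θ).symm w).1, ((sliceEquiv θ).symm w).2) := rfl

/-- The source of `sliceCodMod θ D` is `sliceEquiv (D.source × ℝ)`. [folklore] -/
theorem sliceCodMod_source (θ : ℝ) (D : OpenPartialHomeomorph (𝔼 3) (𝔼 3)) :
    (sliceCodMod θ D).source = {w | ((sliceEquiv θ).symm w).1 ∈ D.source} := by
  ext w
  simp [sliceCodMod]

/-- The target of `sliceCodMod θ D` is `sliceEquiv (D.target × ℝ)`. [folklore] -/
theorem sliceCodMod_target (θ : ℝ) (D : OpenPartialHomeomorph (𝔼 3) (𝔼 3)) :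
    (sliceCodMod θ D).target = {w | ((sliceEquiv θ).symm w).1 ∈ D.target} := by
  ext w
  simp [sliceCodMod]

/-- `sliceCodMod θ D` is smooth on its source when `D` is. [folklore] -/
theorem contDiffOn_sliceCodMod (θ : ℝ) (D : OpenPartialHomeomorph (𝔼 3) (𝔼 3))
    (hD : ContDiffOn ℝ ∞ D D.source) :
    ContDiffOn ℝ ∞ (sliceCodMod θ D) (sliceCodMod θ D).source := by
  rw [sliceCodMod_source]
  have h1 : ContDiffOn ℝ ∞ (fun w : 𝔼 4 => (D ((sliceEquiv θ).symm w).1, ((sliceEquiv θ).symm w).2))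
      {w | ((sliceEquiv θ).symm w).1 ∈ D.source} := by
    refine ContDiffOn.prodMk ?_ ?_
    · exact hD.comp ((sliceEquiv θ).symm.contDiff.fst.contDiffOn) fun w hw => hw
    · exact (sliceEquiv θ).symm.contDiff.snd.contDiffOn
  exact (sliceEquiv θ).contDiff.comp_contDiffOn h1

/-- The inverse of `sliceCodMod θ D` is smooth on its target when `D⁻¹` is. [folklore] -/
theorem contDiffOn_sliceCodMod_symm (θ : ℝ) (D : OpenPartialHomeomorph (𝔼 3) (𝔼 3))
    (hD' : ContDiffOn ℝ ∞ D.symm D.target) :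
    ContDiffOn ℝ ∞ (sliceCodMod θ D).symm (sliceCodMod θ D).target := by
  rw [sliceCodMod_target]
  have h1 : ContDiffOn ℝ ∞ (fun w : 𝔼 4 => (D.symm ((sliceEquiv θ).symm w).1, ((sliceEquiv θ).symm w).2))
      {w | ((sliceEquiv θ).symm w).1 ∈ D.target} := by
    refine ContDiffOn.prodMk ?_ ?_
    · exact hD'.comp ((sliceEquiv θ).symm.contDiff.fst.contDiffOn) fun w hw => hw
    · exact (sliceEquiv θ).symm.contDiff.snd.contDiffOn
  have : ((sliceCodMod θ D).symm : 𝔼 4 → 𝔼 4) =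
      fun w => sliceEquiv θ (D.symm ((sliceEquiv θ).symm w).1, ((sliceEquiv θ).symm w).2) :=
    funext fun w => sliceCodMod_symm_apply θ D w
  rw [this]
  exact (sliceEquiv θ).contDiff.comp_contDiffOn h1

/-- **Reduction of the immersion property of the slice map at `x`** to a chart `e` of the atlas
of `𝔻³` at `x` and a partial diffeomorphism `D` of `ℝ³` extending `e⁻¹`; the codomain chart is
`σ_{p_θ}/2` followed by `sliceEquiv ∘ (D × id) ∘ sliceEquiv⁻¹`, in which the slice map reads
`y ↦ sliceEquiv (y, 0)`. [folklore] -/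
theorem isImmersionAtOfComplement_sliceMap_of_charts (θ : ℝ) {x : 𝔻 3}
    (e : OpenPartialHomeomorph (𝔻 3) (EuclideanHalfSpace 3))
    (he : e ∈ atlas (EuclideanHalfSpace 3) (𝔻 3)) (hx : x ∈ e.source)
    (D : OpenPartialHomeomorph (𝔼 3) (𝔼 3)) (hD : ContDiffOn ℝ ∞ D D.source)
    (hD' : ContDiffOn ℝ ∞ D.symm D.target) (hxD : (x : 𝔼 3) ∈ D.source)
    (htarget : ∀ z ∈ e.target, z.val ∈ D.target)
    (hsymm : ∀ z ∈ e.target, ((e.symm z : 𝔻 3) : 𝔼 3) = D.symm z.val) :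
    Manifold.IsImmersionAtOfComplement ℝ (𝓡∂ 3) (𝓡 4) ∞ (sliceMap θ) x := by
  refine Manifold.IsImmersionAtOfComplement.mk_of_continuousAt
    (continuous_sliceMap θ).continuousAt (sliceEquiv θ)
    e ((stereographic' 4 (slicePole θ) ≫ₕ halvingChart 3) ≫ₕ sliceCodMod θ D) hx ?_
    (IsManifold.subset_maximalAtlas he)
    (trans_mem_maximalAtlas_of_contDiffOn (stereographic'_trans_halvingChart_mem_maximalAtlas (slicePole θ))
      _ (contDiffOn_sliceCodMod θ D hD) (contDiffOn_sliceCodMod_symm θ D hD')) ?_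
  · rw [OpenPartialHomeomorph.trans_source, mem_inter_iff, mem_preimage, sliceCodMod_source,
      OpenPartialHomeomorph.trans_source, mem_inter_iff, mem_preimage, mem_setOf_eq,
      OpenPartialHomeomorph.trans_apply, stereographic'_sliceMap, halvingChart_apply, smul_smul,
      show ((2⁻¹ : ℝ) * 2) = 1 by norm_num, one_smul, sliceEquiv_symm_sliceEmb]
    exact ⟨⟨sliceMap_mem_source θ x, by simp [halvingChart_source]⟩, hxD⟩
  · intro z hz
    rw [OpenPartialHomeomorph.extend_target] at hz
    obtain ⟨hz, z, rfl⟩ := hz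
    rw [mem_preimage, ModelWithCorners.left_inv] at hz
    simp only [comp_apply, OpenPartialHomeomorph.extend_coe, OpenPartialHomeomorph.extend_coe_symm,
      ModelWithCorners.left_inv, modelWithCornersSelf_coe, id, OpenPartialHomeomorph.trans_apply,
      stereographic'_sliceMap, halvingChart_apply, smul_smul]
    rw [show ((2⁻¹ : ℝ) * 2) = 1 by norm_num, one_smul, hsymm z hz, sliceCodMod_apply,
      sliceEquiv_symm_sliceEmb, D.right_inv (htarget z hz)]
    rfl

/-- The slice map is an immersion at interior points. [folklore] -/
theorem isImmersionAtOfComplement_sliceMap_of_norm_lt_one (θ : ℝ) {x : 𝔻 3}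
    (hx : ‖(x : 𝔼 3)‖ < 1) :
    Manifold.IsImmersionAtOfComplement ℝ (𝓡∂ 3) (𝓡 4) ∞ (sliceMap θ) x := by
  set D : OpenPartialHomeomorph (𝔼 3) (𝔼 3) :=
    (Homeomorph.addRight ((2 : ℝ) • closedBallBaseVector 2)).toOpenPartialHomeomorph with hD
  refine isImmersionAtOfComplement_sliceMap_of_charts θ (closedBallInteriorChart 2)
    (mem_insert _ _) hx D ?_ ?_ (mem_univ _) (fun z _ => mem_univ _) fun z hz => ?_
  · exact (contDiff_id.add contDiff_const).contDiffOn
  · exact (contDiff_id.sub contDiff_const).contDiffOn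
  · rw [coe_closedBallInteriorChart_symm_apply (le_of_lt hz), hD,
      Homeomorph.toOpenPartialHomeomorph_symm_apply, Homeomorph.addRight_symm,
      Homeomorph.coe_addRight, sub_eq_add_neg]

/-- The slice map is an immersion at boundary points. [folklore] -/
theorem isImmersionAtOfComplement_sliceMap_of_norm_eq_one (θ : ℝ) {x : 𝔻 3}
    (hx : ‖(x : 𝔼 3)‖ = 1) :
    Manifold.IsImmersionAtOfComplement ℝ (𝓡∂ 3) (𝓡 4) ∞ (sliceMap θ) x := by
  set p : 𝕊 2 := ⟨x, mem_sphere_zero_iff_norm.2 hx⟩ with hp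
  have hxe : x ∈ (closedBallBoundaryChart p).source := by
    have := mem_chart_source (EuclideanHalfSpace 3) x
    rwa [closedBall_chartAt_of_norm_eq_one hx] at this
  refine isImmersionAtOfComplement_sliceMap_of_charts θ (closedBallBoundaryChart p)
    (mem_insert_of_mem _ (mem_range_self p)) hxe (polarChart p) (contDiffOn_polarChart p)
    (contDiff_polarChart_symm p).contDiffOn hxe (fun z hz => hz) fun z hz =>
    coe_closedBallBoundaryChart_symm_eq_polarChart_symm p (le_of_lt hz)

/-- **The slice map is an immersion.** [folklore] -/
theorem isImmersion_sliceMap (θ : ℝ) : Manifold.IsImmersion (𝓡∂ 3) (𝓡 4) ∞ (sliceMap θ) := by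
  refine Manifold.IsImmersionOfComplement.isImmersion (F := ℝ) fun x => ?_
  by_cases hx : ‖(x : 𝔼 3)‖ < 1
  · exact isImmersionAtOfComplement_sliceMap_of_norm_lt_one θ hx
  · exact isImmersionAtOfComplement_sliceMap_of_norm_eq_one θ
      ((mem_closedBall_zero_iff.1 x.2).antisymm (not_lt.1 hx))

/-- **The slice map `𝔻³ → S⁴` is a smooth embedding** of the closed `3`-ball (with its
manifold-with-boundary structure `Literature.Topology.FourManifolds.instChartedSpaceClosedBall`) onto a closed half great
`3`-sphere of `S⁴` — an immersion in Mathlib's chart sense and a topological embedding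
(Hirsch, *Differential Topology*, §1.1, §1.4). [folklore] -/
theorem isSmoothEmbedding_sliceMap (θ : ℝ) :
    Manifold.IsSmoothEmbedding (𝓡∂ 3) (𝓡 4) ∞ (sliceMap θ) :=
  ⟨isImmersion_sliceMap θ, isEmbedding_sliceMap θ⟩


/-! ### Assembly of clause (iii) -/

/-- At angle `0` the half great `3`-sphere is `{x₁ = 0 ≤ x₀}` (the form of
`GayKirby.sphereSector_two_inter_zero`). [folklore] -/
theorem halfGreatSphere_zero : halfGreatSphere 0 = {x : 𝕊 4 | 0 ≤ (x : 𝔼 5) 0 ∧ (x : 𝔼 5) 1 = 0} := by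
  ext x
  simp only [halfGreatSphere, Real.cos_zero, mul_one, Real.sin_zero, mul_zero, mem_setOf_eq]
  constructor
  · rintro ⟨s, hs, h0, h1⟩
    exact ⟨h0 ▸ hs, h1⟩
  · rintro ⟨h0, h1⟩
    exact ⟨_, h0, rfl, h1⟩

/-- **Every double intersection `X_i ∩ X_j` (`i ≠ j`) of Gay–Kirby's sectors is a closed half great
`3`-sphere `R_θ`** (`θ = 2π/3` for `{0, 1}`, `4π/3` for `{1, 2}`, `0` for `{0, 2}`).
[cite: GayKirby2016, §2 (arXiv p. 5), first example] -/
theorem exists_inter_eq_halfGreatSphere (i j : Fin 3) (hij : i ≠ j) :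
    ∃ θ : ℝ, sphereSector i ∩ sphereSector j = halfGreatSphere θ := by
  fin_cases i <;> fin_cases j
  · exact absurd rfl hij
  · exact ⟨_, sphereSector_zero_inter_one⟩
  · exact ⟨0, (inter_comm _ _).trans (sphereSector_two_inter_zero.trans halfGreatSphere_zero.symm)⟩
  · exact ⟨_, (inter_comm _ _).trans sphereSector_zero_inter_one⟩
  · exact absurd rfl hij
  · exact ⟨_, sphereSector_one_inter_two⟩
  · exact ⟨0, sphereSector_two_inter_zero.trans halfGreatSphere_zero.symm⟩
  · exact ⟨_, (inter_comm _ _).trans sphereSector_one_inter_two⟩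
  · exact absurd rfl hij

end GayKirby

/-- **Clause (iii) of `Literature.Topology.FourManifolds.IsGKTrisection` for Gay–Kirby's sectors of `S⁴` holds** — discharge of the
named fact `Literature.Topology.FourManifolds.sphereSector_handlebodies` (`SphereTrisections.lean`): for `i ≠ j` the double
intersection `X_i ∩ X_j` is the image of the closed unit `3`-ball `𝔻³` — a compact connected smooth
`3`-manifold with boundary with one `0`-handle and no `1`-handle
(`Literature.hasHandleDecomposition_closedBall 2`, `Literature.connectedSpace_closedBall 2`) — under the smooth
embedding `GayKirby.sliceMap θ` (`θ` the angle of the common boundary ray,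
`GayKirby.exists_inter_eq_halfGreatSphere`), whose range is `X_i ∩ X_j`
(`GayKirby.range_sliceMap`) and which maps `∂𝔻³` onto `X₀ ∩ X₁ ∩ X₂ = {z = 0} ∩ S⁴`
(`GayKirby.image_sliceMap_boundary`, `GayKirby.iInter_sphereSector_eq`).  Print (Gay–Kirby,
paragraph after Def. 1): "consider the handlebodies `H_{ij} = X_i ∩ X_j` and the central genus `g`
surface `F_g = X_1 ∩ X_2 ∩ X_3 = ∂H_{ij}`"; for the first example of §2, `g = 0` and the `H_{ij}`
are `3`-balls. [cite: GayKirby2016, §2 (arXiv p. 5), first example; Def. 1, second bullet and the following paragraph (arXiv p. 3)] -/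
theorem sphereSector_handlebodies_holds : sphereSector_handlebodies := by
  intro i j hij
  obtain ⟨θ, hθ⟩ := GayKirby.exists_inter_eq_halfGreatSphere i j hij
  haveI : ConnectedSpace (𝔻 3) := connectedSpace_closedBall 2
  refine ⟨𝔻 3, inferInstance, inferInstance, GayKirby.sliceMap θ, inferInstance, inferInstance,
    inferInstance, hasHandleDecomposition_closedBall 2, GayKirby.isSmoothEmbedding_sliceMap θ, ?_, ?_⟩
  · rw [GayKirby.range_sliceMap, hθ]
  · rw [GayKirby.image_sliceMap_boundary, GayKirby.iInter_sphereSector_eq]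

/-- **The genus-`0` fact now follows from clause (ii) alone**: `sphereSector_sectors` (the sectors
are `4`-balls with corners along `F`) implies `sphereSector_isBalancedGKTrisection`, clauses (i)
and (iii) being proved (`GayKirby.iUnion_sphereSector_eq_univ`, `sphereSector_handlebodies_holds`);
clause (ii) itself is discharged in `SphereTrisectionsSectors.lean`
(`sphereSector_isBalancedGKTrisection_holds`). [cite: GayKirby2016, §2 (arXiv p. 5), first example] -/
theorem sphereSector_isBalancedGKTrisection_of_sectors (h₂ : sphereSector_sectors) :
    sphereSector_isBalancedGKTrisection :=
  sphereSector_isBalancedGKTrisection_of h₂ sphereSector_handlebodies_holds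

/-- **(d′) from clause (ii) and stabilisation (c′)**: the standard `(3 + 3m, 1 + m)`-trisections of
the round `S⁴` (`sphere_gkTrisections`) follow from the two remaining geometric named facts
`sphereSector_sectors` (GK §2, first example: the sectors are `4`-balls with corners) and
`exists_stabilized_gkTrisection` (GK Def. 8 / Lemma 10 with AGK Thm. 5); with clause (ii) discharged
(`SphereTrisectionsSectors.lean`) this becomes `sphere_gkTrisections_of_stabilization` there.
[cite: GayKirby2016, §2 (arXiv p. 5), first three examples; Def. 8 and Lemma 10 (arXiv p. 4)] -/
theorem sphere_gkTrisections_of_sectors (h₂ : sphereSector_sectors)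
    (hc : exists_stabilized_gkTrisection.{0}) : sphere_gkTrisections :=
  sphere_gkTrisections_of_clauses h₂ sphereSector_handlebodies_holds hc

end Literature.Topology.FourManifolds
end
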